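import Summits.AnomalousDissipation.AnomalousDissipation.Theorems.GalerkinInvariantLoud.Negative.Absorbing

/-!
# `taylorConverse` and `certificate_excludes_cone` — the proved companions of the line `taylor-cone-homogenisation`
# (crux stmt-AnomalousDissipation-14283, `MomentParity.GalerkinInvariantLoud`)

Two kernel-checked facts about the crux that the line's skeleton
(`Cruxes/GalerkinInvariantLoud/Lines/taylor_cone_homogenisation.lean`, lead prover-line-stmt-AnomalousDissipation-14283-0)
states next to its stubs, landed here so that the library — not only the crux work file — carries them:

* `taylorConverse` — **GIL ⇒ TSE with `κ := ε/E`**: every witness family of `GalerkinInvariantLoud` is a family of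
  all-order invariant level-`N` laws in the Taylor cone `κ·e(μ) ≤ D(μ)` with ONE `κ > 0`, and the force is `≠ 0`
  (energy row + Cauchy–Schwarz, `ensembleDissipation_le_of_polyStationary`). Together with the landed
  `TaylorReduction.stub_taylorReduction` (TSE ⇒ GIL given the landed energy floor `EnergyFloor.stub_energyFloor`) this
  makes the Taylor-scale ensemble statement TSE EQUIVALENT to the crux: the cone is a lossless currency, and the line's
  one open stub `stub_oneTrajectoryTaylor` (one orbit per `(j, N)` with cumulative Taylor ratio `≥ κ`) is crux-sized.
* `certificate_excludes_cone` — the disprover-facing half: a one-multiplier polynomial certificate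
  `⟨F(u), ∇p(u)⟩ + δ ≤ κ|u|² − ν‖∇u‖²` on the level-`N` fields of a ball excludes every cone witness supported there
  (`D(μ) + δ ≤ κ·e(μ)`), by integrating the inequality against the law (its `p`-row vanishes).

Vocabulary: `IsLevel`, `IsBandTest`, `polyGrad`, `IsPolyStationary` (`QuarticGate/Negative/LevelCeiling.lean`),
`integrable_norm_pow_of_ae_le` (`GalerkinInvariantLoud/Negative/Clauses.lean`), `toReal_eGradNormSq_le_of_isLevel`
(`…/Absorbing.lean`). Folklore mathematics (FMRT 2001 Ch. IV energy row; Tobasco–Goluskin–Doering auxiliary functionals).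
-/

set_option linter.dupNamespace false

noncomputable section

namespace Summit.AnomalousDissipation.AnomalousDissipation.Theorems.GalerkinInvariantLoud.TaylorConverse

open MeasureTheory Filter Topology Set
open scoped ENNReal
open Literature.Analysis.FunctionSpaces Literature.Analysis.FluidPDE
open Summit.AnomalousDissipation.AnomalousDissipation.Theses.MomentParity
open Summit.AnomalousDissipation.AnomalousDissipation.Theorems.QuarticGate.Negative
open Summit.AnomalousDissipation.AnomalousDissipation.Theorems.GalerkinInvariantLoud.Negative
  (integrable_norm_pow_of_ae_le toReal_eGradNormSq_le_of_isLevel)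

/-- **TaylorConverse: the transfer is lossless — GIL ⇒ TSE with `κ := ε/E`.** A witness at `j = 0`
gives `ε ≤ ‖f‖₂√E` (energy row + Cauchy–Schwarz: `ensembleDissipation_le_of_polyStationary`), whence `E > 0` and
`f ≠ 0`; then `(ε/E)·e ≤ (ε/E)·E = ε ≤ D` on every witness. [folklore] -/
theorem taylorConverse : GalerkinInvariantLoud →
    ∃ f : UnitAddTorus (Fin 3) → EuclideanSpace ℝ (Fin 3),
      Torus.IsSmooth f ∧ Torus.IsDivFree f ∧ Torus.HasZeroMean f ∧ f ≠ 0 ∧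
      ∃ (ν : ℕ → ℝ) (κ : ℝ), (∀ j, 0 < ν j) ∧ Tendsto ν atTop (𝓝 0) ∧ 0 < κ ∧
        ∀ j : ℕ, ∃ R : ℝ, ∃ᶠ N in atTop, ∃ μ : Measure (Torus.energySpace (Fin 3)),
          IsProbabilityMeasure μ ∧ (∀ᵐ u ∂μ, IsLevel N u) ∧ (∀ᵐ u ∂μ, ‖u‖ ≤ R) ∧
          (∀ d : ℕ, IsPolyStationary (ν j) f N d μ) ∧
          κ * Torus.ensembleEnergy μ ≤ Torus.ensembleDissipation (ν j) μ := by
  rintro ⟨f, hfs, hfd, hfz, ν, E, ε, hν, hν0, hε, hj⟩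
  -- one witness (at `j = 0`) gives the force floor `ε ≤ ‖f‖₂ √E`, whence `0 < E` and `f ≠ 0`
  obtain ⟨R₀, hR₀⟩ := hj 0
  obtain ⟨N₀, μ₀, hp₀, hl₀, hRμ₀, hinv₀, hE₀, hε₀⟩ := hR₀.exists
  have hforce : ε ≤ Real.sqrt (∫ x, ‖f x‖ ^ 2) * Real.sqrt E := by
    haveI := hp₀
    have h2 : Integrable (fun u : Torus.energySpace (Fin 3) => ‖u‖ ^ 2) μ₀ :=
      integrable_norm_pow_of_ae_le hRμ₀ 2
    have hst : IsPolyStationary (ν 0) f N₀ 3 μ₀ := fun m g P hg _ => hinv₀ m g P hg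
    calc ε ≤ Torus.ensembleDissipation (ν 0) μ₀ := hε₀
      _ ≤ Real.sqrt (∫ x, ‖f x‖ ^ 2) * Real.sqrt (Torus.ensembleEnergy μ₀) :=
          ensembleDissipation_le_of_polyStationary f (hfs.memLp 2) hl₀ h2 le_rfl hst
      _ ≤ Real.sqrt (∫ x, ‖f x‖ ^ 2) * Real.sqrt E := by gcongr
  have hE : 0 < E := by
    by_contra hE
    push Not at hE
    have h0 : Real.sqrt E = 0 := Real.sqrt_eq_zero'.mpr hE
    rw [h0, mul_zero] at hforce
    linarith
  have hf0 : f ≠ 0 := by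
    rintro rfl
    have h0 : (∫ x : UnitAddTorus (Fin 3),
        ‖(0 : UnitAddTorus (Fin 3) → EuclideanSpace ℝ (Fin 3)) x‖ ^ 2) = 0 := by
      simp
    rw [h0, Real.sqrt_zero, zero_mul] at hforce
    linarith
  refine ⟨f, hfs, hfd, hfz, hf0, ν, ε / E, hν, hν0, div_pos hε hE, fun j => ?_⟩
  obtain ⟨R, hR⟩ := hj j
  refine ⟨R, hR.mono ?_⟩
  rintro N ⟨μ, hp, hl, hRμ, hinv, hEμ, hεμ⟩
  refine ⟨μ, hp, hl, hRμ, fun d m g P hg _ => hinv m g P hg, ?_⟩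
  calc ε / E * Torus.ensembleEnergy μ ≤ ε / E * E :=
        mul_le_mul_of_nonneg_left hEμ (div_pos hε hE).le
    _ = ε := div_mul_cancel₀ ε hE.ne'
    _ ≤ Torus.ensembleDissipation (ν j) μ := hεμ

/-- The dissipation of a law carried by level-`N` fields is a Bochner integral: the spectral enstrophy is Borel
on `H` (`measurable_eGradNormSq_coe`) and finite on level-`N` fields (Bernstein), so
`ν·(∫⁻‖∇u‖²dμ).toReal = ν∫(‖∇u‖²).toReal dμ`. [folklore] -/
theorem ensembleDissipation_eq_integral_of_isLevel {ν : ℝ} {N : ℕ}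
    {μ : Measure (Torus.energySpace (Fin 3))} (hl : ∀ᵐ u ∂μ, IsLevel N u) :
    Torus.ensembleDissipation ν μ =
      ν * ∫ u, (Torus.eGradNormSq (u.1 : UnitAddTorus (Fin 3) → EuclideanSpace ℝ (Fin 3))).toReal ∂μ := by
  have hm : AEMeasurable (fun u : Torus.energySpace (Fin 3) =>
      Torus.eGradNormSq (u.1 : UnitAddTorus (Fin 3) → EuclideanSpace ℝ (Fin 3))) μ :=
    (Torus.measurable_eGradNormSq_coe (d := Fin 3)).aemeasurable
  have hfin : ∀ᵐ u ∂μ,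
      Torus.eGradNormSq (u.1 : UnitAddTorus (Fin 3) → EuclideanSpace ℝ (Fin 3)) < ⊤ :=
    hl.mono fun u hu => (eGradNormSq_le_of_level u.1 hu).trans_lt
      (ENNReal.mul_lt_top ENNReal.ofReal_lt_top (ENNReal.pow_lt_top enorm_lt_top))
  rw [integral_toReal hm hfin]
  rfl

/-- **One-multiplier certificates exclude the cone (the disprover's target in closed form).** At fixed `(ν, N)` let
`p = P((u,g₁),…,(u,gₘ))` be a polynomial cylindrical observable whose generator row obeys
`⟨F(u), ∇p(u)⟩ + δ ≤ κ|u|² − ν‖∇u‖²` on the level-`N` fields of the ball `‖u‖ ≤ ρ`. Then every level-`N` probability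
law supported in that ball whose `p`-row vanishes (in particular every all-order invariant law, when the `gᵢ` are band
tests) satisfies `D(μ) + δ ≤ κ·e(μ)` — it is NOT in the cone `κ·e ≤ D` once `δ > 0`. Proof: integrate the inequality.
(Tobasco–Goluskin–Doering auxiliary-functional bounds, here for invariant laws of the truncation.) [folklore] -/
theorem certificate_excludes_cone {f : UnitAddTorus (Fin 3) → EuclideanSpace ℝ (Fin 3)} {ν κ δ ρ : ℝ}
    {N m : ℕ} (g : Fin m → UnitAddTorus (Fin 3) → EuclideanSpace ℝ (Fin 3)) (P : MvPolynomial (Fin m) ℝ)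
    (hcert : ∀ u : Torus.energySpace (Fin 3), IsLevel N u → ‖u‖ ≤ ρ →
      Torus.nsGeneratorPairing ν f u (polyGrad g P u) + δ ≤
        κ * ‖u‖ ^ 2 - ν * (Torus.eGradNormSq (u.1 : UnitAddTorus (Fin 3) → EuclideanSpace ℝ (Fin 3))).toReal)
    {μ : Measure (Torus.energySpace (Fin 3))} [IsProbabilityMeasure μ]
    (hl : ∀ᵐ u ∂μ, IsLevel N u) (hR : ∀ᵐ u ∂μ, ‖u‖ ≤ ρ)
    (hrow : Integrable (fun u => Torus.nsGeneratorPairing ν f u (polyGrad g P u)) μ ∧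
      ∫ u, Torus.nsGeneratorPairing ν f u (polyGrad g P u) ∂μ = 0) :
    Torus.ensembleDissipation ν μ + δ ≤ κ * Torus.ensembleEnergy μ := by
  have h2 : Integrable (fun u : Torus.energySpace (Fin 3) => ‖u‖ ^ 2) μ := integrable_norm_pow_of_ae_le hR 2
  have hGm : AEStronglyMeasurable (fun u : Torus.energySpace (Fin 3) =>
      (Torus.eGradNormSq (u.1 : UnitAddTorus (Fin 3) → EuclideanSpace ℝ (Fin 3))).toReal) μ :=
    (Torus.measurable_eGradNormSq_coe (d := Fin 3)).ennreal_toReal.aestronglyMeasurable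
  have hGint : Integrable (fun u : Torus.energySpace (Fin 3) =>
      (Torus.eGradNormSq (u.1 : UnitAddTorus (Fin 3) → EuclideanSpace ℝ (Fin 3))).toReal) μ := by
    refine Integrable.mono' (h2.const_mul (4 * Real.pi ^ 2 * (N : ℝ) ^ 2)) hGm ?_
    filter_upwards [hl] with u hu
    rw [Real.norm_of_nonneg ENNReal.toReal_nonneg]
    exact toReal_eGradNormSq_le_of_isLevel hu
  have hI1 : Integrable (fun u : Torus.energySpace (Fin 3) =>
      Torus.nsGeneratorPairing ν f u (polyGrad g P u) + δ) μ := hrow.1.add (integrable_const δ)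
  have hI2 : Integrable (fun u : Torus.energySpace (Fin 3) => κ * ‖u‖ ^ 2 -
      ν * (Torus.eGradNormSq (u.1 : UnitAddTorus (Fin 3) → EuclideanSpace ℝ (Fin 3))).toReal) μ :=
    (h2.const_mul κ).sub (hGint.const_mul ν)
  have hineq : ∀ᵐ u ∂μ, Torus.nsGeneratorPairing ν f u (polyGrad g P u) + δ ≤ κ * ‖u‖ ^ 2 -
      ν * (Torus.eGradNormSq (u.1 : UnitAddTorus (Fin 3) → EuclideanSpace ℝ (Fin 3))).toReal := by
    filter_upwards [hl, hR] with u hu hur using hcert u hu hur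
  have hint := integral_mono_ae hI1 hI2 hineq
  have hA : ∫ u, Torus.nsGeneratorPairing ν f u (polyGrad g P u) + δ ∂μ = δ := by
    rw [integral_add hrow.1 (integrable_const δ), hrow.2, integral_const, smul_eq_mul, probReal_univ]
    ring
  have hB : ∫ u, κ * ‖u‖ ^ 2 -
      ν * (Torus.eGradNormSq (u.1 : UnitAddTorus (Fin 3) → EuclideanSpace ℝ (Fin 3))).toReal ∂μ =
      κ * Torus.ensembleEnergy μ - Torus.ensembleDissipation ν μ := by
    rw [integral_sub (h2.const_mul κ) (hGint.const_mul ν), integral_const_mul, integral_const_mul,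
      ensembleDissipation_eq_integral_of_isLevel hl]
    rfl
  rw [hA, hB] at hint
  linarith

end Summit.AnomalousDissipation.AnomalousDissipation.Theorems.GalerkinInvariantLoud.TaylorConverse

end
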